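import Mathlib
import HarnessLib
import Literature.Analysis.FluidPDE.AxisymmetricEuler
import Summits.NavierStokesRegularity.NavierStokesRegularity.Theorems.PoloidalWindowRigidity.Negative.ResidueStubFalseWithoutMild

/-!
# Crux `PoloidalWindowRigidity` (K2, stmt-NavierStokesRegularity-19708, route `PoloidalWindowDoor`) — negative side:
# the drifting discretely self-similar cellular profile (definitions, derivative, scale-sharp rates, (R)(C)(D)(P)(F))

Negative-side support (refuter seat ns-regularity-refuter1, cell ns-regularity-ideate; D-0081 §C), fourth file of the
series (`…Negative.FalseWithoutMild`, `…Negative.CellField`, `…Negative.NonflatStubFalseWithoutMild`,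
`…Negative.ResidueStubFalseWithoutMild`); its companion `…Negative.ResidueFalseWithClassRates` carries the kinematic
exclusions, the singularity and the negative lemma.

The three earlier witnesses are SEPARATED, `(−t)^{-1/2} U(x)`: their gradients decay like `(−t)^{-1/2}`, so for `−t`
large they violate the scale-sharp rates `‖Dv(t)‖ ≤ C₁/(−t)`, `‖curl v(t)‖ ≤ C₂/(−t)` which the K2 line has banked as
consequences of (M)+(R) (tree `…ClassRate.exists_fderiv_rate_of_class` / `exists_curl_rate_of_class`). The profile
of this file removes that loophole: the DRIFTING SELF-SIMILAR cellular profile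

  `w(t, x) = (−t)^{-1/2} V(A_t x)`,  `A_t x = (−t)^{-1/2} x + log(−t) e₁`

(`driftProfile`, `driftShift`; `V` = `cellField` of `…Negative.CellField`). It is discretely self-similar
(`λ w(λ²t, λx) = w` for `λ = e^{π}`, by `2π`-periodicity of `V` in `x₁`) but not self-similar. This file proves:
`Dw(t)(x) = (−t)^{-1} DV(A_t x)` (`fderiv_driftProfile`), the pointwise bound `‖DV(y) w‖ ≤ 8‖w‖`
(`norm_cellDeriv_apply_le`), **the ClassRate-shaped rates `‖Dw(t)(x)‖ ≤ 8/(−t)`, `‖curl w(t)(x)‖ ≤ 4/(−t)`**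
(`norm_fderiv_driftProfile_le`, `norm_curl_driftProfile_le`), the curl in coordinates, and the slice identities
(R) `‖w(t)‖ ≤ 4(−t)^{-1/2}`, (C) continuity on the open slab, (D) divergence-free, (P) poloidal along `e₂`,
(F) the frozen constraint — images of the cellular identities under the affine maps `A_t`.

WHAT THIS IS NOT: not a claim about Navier–Stokes — an explicit kinematic profile. [folklore]
-/

noncomputable section

namespace Summit.NavierStokesRegularity.NavierStokesRegularity.Theorems.PoloidalWindowRigidity.Negative

open MeasureTheory Set Function Filter Topology Metric
open scoped RealInnerProductSpace InnerProductSpace ENNReal NNReal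
open Literature.Analysis Literature.Analysis.FluidPDE

/-! ## The similarity variable with logarithmic drift and the profile -/

/-- The drifting similarity variable `A_t x = (−t)^{-1/2} x + log(−t) e₁`. [folklore] -/
def driftShift (t : ℝ) (x : EuclideanSpace ℝ (Fin 3)) : EuclideanSpace ℝ (Fin 3) :=
  cellAmp t • x + Real.log (-t) • EuclideanSpace.single (1 : Fin 3) (1 : ℝ)

/-- The drifting self-similar cellular profile `w(t, x) = (−t)^{-1/2} V(A_t x)`. [folklore] -/
def driftProfile (t : ℝ) (x : EuclideanSpace ℝ (Fin 3)) : EuclideanSpace ℝ (Fin 3) :=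
  cellAmp t • cellField (driftShift t x)

/-- `(A_t x)₀ = (−t)^{-1/2} x₀`. [folklore] -/
theorem driftShift_apply_zero (t : ℝ) (x : EuclideanSpace ℝ (Fin 3)) : driftShift t x 0 = cellAmp t * x 0 := by
  simp [driftShift]

/-- `(A_t x)₁ = (−t)^{-1/2} x₁ + log(−t)`. [folklore] -/
theorem driftShift_apply_one (t : ℝ) (x : EuclideanSpace ℝ (Fin 3)) :
    driftShift t x 1 = cellAmp t * x 1 + Real.log (-t) := by
  simp [driftShift]

/-- `(A_t x)₂ = (−t)^{-1/2} x₂`. [folklore] -/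
theorem driftShift_apply_two (t : ℝ) (x : EuclideanSpace ℝ (Fin 3)) : driftShift t x 2 = cellAmp t * x 2 := by
  simp [driftShift]

/-- `A_t` hits every point: `A_t ((−t)^{1/2}(y − log(−t) e₁)) = y` for `t < 0`. [folklore] -/
theorem driftShift_invPoint {t : ℝ} (ht : t < 0) (y : EuclideanSpace ℝ (Fin 3)) :
    driftShift t ((cellAmp t)⁻¹ • (y - Real.log (-t) • EuclideanSpace.single (1 : Fin 3) (1 : ℝ))) = y := by
  have hc := (cellAmp_pos ht).ne'
  simp only [driftShift, smul_smul, mul_inv_cancel₀ hc, one_smul, sub_add_cancel]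

/-- `A_t` is affine: `A_t (x + l e) = A_t x + (−t)^{-1/2} l e`. [folklore] -/
theorem driftShift_add_smul (t : ℝ) (x : EuclideanSpace ℝ (Fin 3)) (l : ℝ) (e : EuclideanSpace ℝ (Fin 3)) :
    driftShift t (x + l • e) = driftShift t x + (cellAmp t * l) • e := by
  simp only [driftShift, smul_add, smul_smul]
  abel

/-- On the slice `t = −1` the similarity variable is `x` itself. [folklore] -/
theorem driftShift_neg_one (x : EuclideanSpace ℝ (Fin 3)) : driftShift (-1) x = x := by
  simp [driftShift, cellAmp]

/-- On the slice `t = −1` the drifting profile is the cellular field (`= cellProfile (−1)`). [folklore] -/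
theorem driftProfile_neg_one : driftProfile (-1) = cellProfile (-1) := by
  funext x
  simp only [driftProfile, cellProfile, driftShift_neg_one]

/-! ## Derivative, rates, curl, divergence -/

/-- `DA_t = (−t)^{-1/2} id`. [folklore] -/
theorem hasFDerivAt_driftShift (t : ℝ) (x : EuclideanSpace ℝ (Fin 3)) :
    HasFDerivAt (driftShift t) (cellAmp t • ContinuousLinearMap.id ℝ (EuclideanSpace ℝ (Fin 3))) x := by
  show HasFDerivAt (fun x => cellAmp t • x + Real.log (-t) • EuclideanSpace.single (1 : Fin 3) (1 : ℝ)) _ x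
  exact ((hasFDerivAt_id x).const_smul (cellAmp t)).add_const _

/-- `Dw(t)(x) = (−t)^{-1/2} DV(A_t x) ∘ DA_t`. [folklore] -/
theorem hasFDerivAt_driftProfile (t : ℝ) (x : EuclideanSpace ℝ (Fin 3)) :
    HasFDerivAt (driftProfile t)
      (cellAmp t • ((cellDeriv (driftShift t x)).comp
        (cellAmp t • ContinuousLinearMap.id ℝ (EuclideanSpace ℝ (Fin 3))))) x := by
  show HasFDerivAt (fun x => cellAmp t • cellField (driftShift t x)) _ x
  exact ((hasFDerivAt_cellField (driftShift t x)).comp x (hasFDerivAt_driftShift t x)).const_smul (cellAmp t)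

/-- `Dw(t)(x) w` in coordinates: `(−t)^{-1} (DV(A_t x) w)ᵢ`. [folklore] -/
theorem fderiv_driftProfile_apply (t : ℝ) (x w : EuclideanSpace ℝ (Fin 3)) (i : Fin 3) :
    fderiv ℝ (driftProfile t) x w i = cellAmp t ^ 2 * cellDeriv (driftShift t x) w i := by
  rw [(hasFDerivAt_driftProfile t x).fderiv]
  simp [sq, mul_assoc]

/-- `Dw(t)(x) = (−t)^{-1} DV(A_t x)` as continuous linear maps. [folklore] -/
theorem fderiv_driftProfile (t : ℝ) (x : EuclideanSpace ℝ (Fin 3)) :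
    fderiv ℝ (driftProfile t) x = (cellAmp t ^ 2) • cellDeriv (driftShift t x) := by
  ext w i
  rw [fderiv_driftProfile_apply]
  simp

/-- `(−t)^{-1/2}` squared is `1/(−t)` for `t < 0`. [folklore] -/
theorem cellAmp_sq {t : ℝ} (ht : t < 0) : cellAmp t ^ 2 = (-t)⁻¹ := by
  rw [cellAmp, inv_pow, Real.sq_sqrt (by linarith)]

/-- Products of two factors of modulus at most one do not increase a modulus. [folklore] -/
theorem abs_mul_mul_le_abs {a b : ℝ} (ha : |a| ≤ 1) (hb : |b| ≤ 1) (w : ℝ) : |a * (b * w)| ≤ |w| := by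
  rw [abs_mul, abs_mul]
  have h1 : |b| * |w| ≤ |w| := by
    have := mul_le_mul_of_nonneg_right hb (abs_nonneg w)
    rwa [one_mul] at this
  have h2 : |a| * (|b| * |w|) ≤ 1 * (|b| * |w|) := mul_le_mul_of_nonneg_right ha (by positivity)
  linarith

/-- Pointwise bound for the cellular derivative: `‖DV(y) w‖ ≤ 8‖w‖`. [folklore] -/
theorem norm_cellDeriv_apply_le (y w : EuclideanSpace ℝ (Fin 3)) : ‖cellDeriv y w‖ ≤ 8 * ‖w‖ := by
  have hw : ∀ i : Fin 3, |w i| ≤ ‖w‖ := by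
    intro i
    have := PiLp.norm_apply_le w i
    rwa [Real.norm_eq_abs] at this
  have hc0 := Real.abs_cos_le_one (y 0)
  have hc1 := Real.abs_cos_le_one (y 1)
  have hc2 := Real.abs_cos_le_one (y 2)
  have hs0 := Real.abs_sin_le_one (y 0)
  have hs1 := Real.abs_sin_le_one (y 1)
  have hs2 := Real.abs_sin_le_one (y 2)
  have hns0 : |-(Real.sin (y 0))| ≤ 1 := by rwa [abs_neg]
  have hns1 : |-(Real.sin (y 1))| ≤ 1 := by rwa [abs_neg]
  have hns2 : |-(Real.sin (y 2))| ≤ 1 := by rwa [abs_neg]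
  have e0 : ‖(EuclideanSpace.single (0 : Fin 3) (1 : ℝ) : EuclideanSpace ℝ (Fin 3))‖ = 1 := by simp
  have e1 : ‖(EuclideanSpace.single (1 : Fin 3) (1 : ℝ) : EuclideanSpace ℝ (Fin 3))‖ = 1 := by simp
  have e2 : ‖(EuclideanSpace.single (2 : Fin 3) (1 : ℝ) : EuclideanSpace ℝ (Fin 3))‖ = 1 := by simp
  rw [cellDeriv_apply]
  refine (norm_add_le _ _).trans ?_
  refine (add_le_add (norm_add_le _ _) le_rfl).trans ?_
  rw [norm_smul, norm_smul, norm_smul, e0, e1, e2, mul_one, mul_one, mul_one, Real.norm_eq_abs,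
    Real.norm_eq_abs, Real.norm_eq_abs]
  -- the three coefficients
  have hA : |Real.cos (y 2) * (-(Real.sin (y 0)) * w 0) + Real.cos (y 0) * (-(Real.sin (y 2)) * w 2)| ≤
      |w 0| + |w 2| :=
    (abs_add_le _ _).trans (add_le_add (abs_mul_mul_le_abs hc2 hns0 _) (abs_mul_mul_le_abs hc0 hns2 _))
  have hB : |Real.cos (y 2) * (-(Real.sin (y 1)) * w 1) + Real.cos (y 1) * (-(Real.sin (y 2)) * w 2)| ≤
      |w 1| + |w 2| :=
    (abs_add_le _ _).trans (add_le_add (abs_mul_mul_le_abs hc2 hns1 _) (abs_mul_mul_le_abs hc1 hns2 _))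
  have hC : |Real.sin (y 2) * (Real.cos (y 0) * w 0 + Real.cos (y 1) * w 1) +
      (Real.sin (y 0) + Real.sin (y 1)) * (Real.cos (y 2) * w 2)| ≤ |w 0| + |w 1| + 2 * |w 2| := by
    refine (abs_add_le _ _).trans ?_
    have h1 : |Real.sin (y 2) * (Real.cos (y 0) * w 0 + Real.cos (y 1) * w 1)| ≤ |w 0| + |w 1| := by
      rw [abs_mul]
      have hin : |Real.cos (y 0) * w 0 + Real.cos (y 1) * w 1| ≤ |w 0| + |w 1| := by
        refine (abs_add_le _ _).trans (add_le_add ?_ ?_)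
        · rw [abs_mul]
          have := mul_le_mul_of_nonneg_right hc0 (abs_nonneg (w 0)); rwa [one_mul] at this
        · rw [abs_mul]
          have := mul_le_mul_of_nonneg_right hc1 (abs_nonneg (w 1)); rwa [one_mul] at this
      have := mul_le_mul hs2 hin (abs_nonneg _) zero_le_one
      rwa [one_mul] at this
    have h2 : |(Real.sin (y 0) + Real.sin (y 1)) * (Real.cos (y 2) * w 2)| ≤ 2 * |w 2| := by
      rw [abs_mul, abs_mul]
      have hsum : |Real.sin (y 0) + Real.sin (y 1)| ≤ 2 := by
        have := abs_add_le (Real.sin (y 0)) (Real.sin (y 1)); linarith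
      have hcw : |Real.cos (y 2)| * |w 2| ≤ |w 2| := by
        have := mul_le_mul_of_nonneg_right hc2 (abs_nonneg (w 2)); rwa [one_mul] at this
      have := mul_le_mul hsum hcw (by positivity) zero_le_two
      linarith
    exact add_le_add h1 h2
  have h0 := hw 0
  have h1 := hw 1
  have h2 := hw 2
  linarith

/-- **The scale-sharp gradient rate (ClassRate shape)**: `‖Dw(t)(x)‖ ≤ 8/(−t)` for `t < 0`. [folklore] -/
theorem norm_fderiv_driftProfile_le {t : ℝ} (ht : t < 0) (x : EuclideanSpace ℝ (Fin 3)) :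
    ‖fderiv ℝ (driftProfile t) x‖ ≤ 8 / (-t) := by
  rw [fderiv_driftProfile, norm_smul, Real.norm_of_nonneg (sq_nonneg _), cellAmp_sq ht, div_eq_inv_mul]
  refine mul_le_mul_of_nonneg_left ?_ (inv_nonneg.2 (by linarith))
  exact ContinuousLinearMap.opNorm_le_bound _ (by norm_num) (norm_cellDeriv_apply_le _)

/-- `curl w(t) = (−t)^{-1} (curl V)(A_t x)`, in coordinates. [folklore] -/
theorem curl_driftProfile (t : ℝ) (x : EuclideanSpace ℝ (Fin 3)) : curl (driftProfile t) x =
    (cellAmp t ^ 2 * (2 * Real.sin (driftShift t x 2) * Real.cos (driftShift t x 1))) •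
        (EuclideanSpace.single (0 : Fin 3) (1 : ℝ) : EuclideanSpace ℝ (Fin 3)) +
      (-(cellAmp t ^ 2 * (2 * Real.sin (driftShift t x 2) * Real.cos (driftShift t x 0)))) •
        (EuclideanSpace.single (1 : Fin 3) (1 : ℝ) : EuclideanSpace ℝ (Fin 3)) := by
  ext i
  fin_cases i <;>
    simp [curl, fderiv_driftProfile, cellDeriv_apply_zero, cellDeriv_apply_one, cellDeriv_apply_two] <;> ring

/-- The first component of `curl w(t)(x)`. [folklore] -/
theorem curl_driftProfile_apply_zero (t : ℝ) (x : EuclideanSpace ℝ (Fin 3)) :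
    curl (driftProfile t) x 0 = cellAmp t ^ 2 * (2 * Real.sin (driftShift t x 2) * Real.cos (driftShift t x 1)) := by
  rw [curl_driftProfile]; simp

/-- The second component of `curl w(t)(x)`. [folklore] -/
theorem curl_driftProfile_apply_one (t : ℝ) (x : EuclideanSpace ℝ (Fin 3)) :
    curl (driftProfile t) x 1 =
      -(cellAmp t ^ 2 * (2 * Real.sin (driftShift t x 2) * Real.cos (driftShift t x 0))) := by
  rw [curl_driftProfile]; simp

/-- The third component of `curl w(t)(x)` vanishes (poloidal along `e₂`). [folklore] -/
theorem curl_driftProfile_apply_two (t : ℝ) (x : EuclideanSpace ℝ (Fin 3)) : curl (driftProfile t) x 2 = 0 := by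
  rw [curl_driftProfile]; simp

/-- **The vorticity rate (ClassRate shape)**: `‖curl w(t)(x)‖ ≤ 4/(−t)` for `t < 0`. [folklore] -/
theorem norm_curl_driftProfile_le {t : ℝ} (ht : t < 0) (x : EuclideanSpace ℝ (Fin 3)) :
    ‖curl (driftProfile t) x‖ ≤ 4 / (-t) := by
  have e0 : ‖(EuclideanSpace.single (0 : Fin 3) (1 : ℝ) : EuclideanSpace ℝ (Fin 3))‖ = 1 := by simp
  have e1 : ‖(EuclideanSpace.single (1 : Fin 3) (1 : ℝ) : EuclideanSpace ℝ (Fin 3))‖ = 1 := by simp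
  have hsq := cellAmp_sq ht
  have hpos : 0 < (-t)⁻¹ := inv_pos.2 (by linarith)
  have key : ∀ a b : ℝ, |2 * Real.sin a * Real.cos b| ≤ 2 := by
    intro a b
    rw [abs_mul, abs_mul, abs_two]
    have hsa := Real.abs_sin_le_one a
    have hcb := Real.abs_cos_le_one b
    nlinarith [abs_nonneg (Real.sin a), abs_nonneg (Real.cos b)]
  have hA : |cellAmp t ^ 2 * (2 * Real.sin (driftShift t x 2) * Real.cos (driftShift t x 1))| ≤ 2 * (-t)⁻¹ := by
    rw [abs_mul, hsq, abs_of_pos hpos]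
    nlinarith [key (driftShift t x 2) (driftShift t x 1)]
  have hB : |-(cellAmp t ^ 2 * (2 * Real.sin (driftShift t x 2) * Real.cos (driftShift t x 0)))| ≤
      2 * (-t)⁻¹ := by
    rw [abs_neg, abs_mul, hsq, abs_of_pos hpos]
    nlinarith [key (driftShift t x 2) (driftShift t x 0)]
  rw [curl_driftProfile]
  refine (norm_add_le _ _).trans ?_
  rw [norm_smul, norm_smul, e0, e1, mul_one, mul_one, Real.norm_eq_abs, Real.norm_eq_abs, div_eq_inv_mul]
  linarith

/-! ## The slice identities (R), (C), (D), (P), (F) -/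

/-- (R) the Type-I time rate with constant `4`. [folklore] -/
theorem hasTypeITimeDecay_driftProfile : HasTypeITimeDecay 4 driftProfile := by
  intro t ht x
  show ‖cellAmp t • cellField (driftShift t x)‖ ≤ 4 / Real.sqrt (-t)
  rw [norm_smul, Real.norm_of_nonneg (cellAmp_nonneg t), cellAmp, div_eq_inv_mul]
  exact mul_le_mul_of_nonneg_left (norm_cellField_le _) (inv_nonneg.2 (Real.sqrt_nonneg _))

/-- (C) continuity on the open backward slab. [folklore] -/
theorem continuousOn_driftProfile :
    ContinuousOn (Function.uncurry driftProfile) (Set.Iio (0 : ℝ) ×ˢ Set.univ) := by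
  have hamp : ContinuousOn (fun z : ℝ × EuclideanSpace ℝ (Fin 3) => cellAmp z.1) (Set.Iio (0 : ℝ) ×ˢ Set.univ) := by
    refine ContinuousOn.inv₀ ?_ fun z hz => (Real.sqrt_pos.2 (neg_pos.2 (show z.1 < 0 from hz.1))).ne'
    exact ((Real.continuous_sqrt.comp continuous_neg).comp continuous_fst).continuousOn
  have hlog : ContinuousOn (fun z : ℝ × EuclideanSpace ℝ (Fin 3) => Real.log (-z.1)) (Set.Iio (0 : ℝ) ×ˢ Set.univ) :=
    (continuous_neg.comp continuous_fst).continuousOn.log fun z hz => (neg_pos.2 (show z.1 < 0 from hz.1)).ne'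
  have hshift : ContinuousOn (fun z : ℝ × EuclideanSpace ℝ (Fin 3) => driftShift z.1 z.2)
      (Set.Iio (0 : ℝ) ×ˢ Set.univ) :=
    (hamp.smul continuousOn_snd).add (hlog.smul continuousOn_const)
  exact hamp.smul (continuous_cellField.comp_continuousOn hshift)

/-- (D) divergence-free slices. [folklore] -/
theorem isDivFree_driftProfile (t : ℝ) : VectorCalculus.IsDivFree (driftProfile t) := by
  intro y
  rw [divergence_eq_sum_inner_fderiv (EuclideanSpace.basisFun (Fin 3) ℝ), Fin.sum_univ_three]
  simp only [EuclideanSpace.basisFun_apply, EuclideanSpace.inner_single_left, map_one, one_mul,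
    fderiv_driftProfile_apply, cellDeriv_apply_zero, cellDeriv_apply_one, cellDeriv_apply_two, PiLp.single_apply]
  simp
  ring

/-- (P) poloidal along `e₂` everywhere on every slice. [folklore] -/
theorem poloidal_driftProfile (s : ℝ) (y : EuclideanSpace ℝ (Fin 3)) :
    ⟪curl (driftProfile s) y, (EuclideanSpace.single (2 : Fin 3) (1 : ℝ) : EuclideanSpace ℝ (Fin 3))⟫_ℝ = 0 := by
  rw [EuclideanSpace.inner_single_right, curl_driftProfile_apply_two]
  simp

/-- (F) the frozen constraint `⟪Dw(s)(y) curl w(s)(y), e₂⟫ = 0`. [folklore] -/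
theorem frozen_driftProfile (s : ℝ) (y : EuclideanSpace ℝ (Fin 3)) :
    ⟪fderiv ℝ (driftProfile s) y (curl (driftProfile s) y),
      (EuclideanSpace.single (2 : Fin 3) (1 : ℝ) : EuclideanSpace ℝ (Fin 3))⟫_ℝ = 0 := by
  rw [EuclideanSpace.inner_single_right, fderiv_driftProfile_apply, cellDeriv_apply_two, curl_driftProfile_apply_zero,
    curl_driftProfile_apply_one, curl_driftProfile_apply_two, RCLike.conj_to_real]
  ring

end Summit.NavierStokesRegularity.NavierStokesRegularity.Theorems.PoloidalWindowRigidity.Negative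

end
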